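import Summits.BirchSwinnertonDyer.BirchSwinnertonDyer.Theorems.ClassRecordThreeEulerHalvesAtThreeCartanSaturatedDictionary
import Summits.BirchSwinnertonDyer.BirchSwinnertonDyer.Theorems.ClassRecordThreeEulerHalvesAtThreeCartanTorusCubeCutPSCube
import Summits.BirchSwinnertonDyer.BirchSwinnertonDyer.Theorems.ClassRecordThreeEulerHalvesAtThreeCartanSupplyMonomialNet
import HarnessLib

/-!
# Crux 23422 `EulerHalvesAtThreeResidualUpperBound` ∕ 19109, line `cartan` v14: **(F2b♮) ⟺ (F2b♭) ⟺ NUM** —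
# the unipotent saturation (SAT₃) FOLLOWS from the mod-3 clause `(𝓛∕3𝓛)^G = 0` for every Cartan torus lattice at `q ≡ 1 (mod 3)`

Seat `bsd-stepL-tam3-p1` g25 (prover, LINE OWNER of crux stmt-BirchSwinnertonDyer-23422 ∕ stmt-BirchSwinnertonDyer-19109; `--supports
stmt-BirchSwinnertonDyer-23422 --as helper`). The v14 skeleton of `Cruxes/EulerHalvesAtThreeResidualUpperBound/Lines/cartan.lean` derives the registered stub
NUM `CartanCorrespondence.CartanOnePlaceDegreeLawAtThree` from the ONE open node (F2b♮) `CartanSaturatedDictionary.CartanHomLatticeSaturatedDictionaryAtThree`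
(bsd-idea-10 g14, p720153: (F2b♮) → (F2b♭) → NUM). THIS FILE proves the CONVERSE (F2b♭) → (F2b♮), so that the reshaped node is EXACTLY as strong as the
registered stub: `saturatedDictionary_iff_onePlaceLaw : (F2b♮) ↔ NUM` (unconditional; the lattice SUPPLY is the tree theorem
`CartanSupply.Monomial.cartanTorusLatticeSupply_holds`). The «INFORMATIONAL, not formalised» paragraph of `…CartanSaturatedDictionary` is now a theorem.

THE FINITE-GROUP THEOREM (`satThree_of_cartanTorusLattice`). Let `q ≡ 1 (mod 3)` be prime, `𝓛` a Cartan torus lattice (`ℤ^d` with a `GL₂(𝔽_q)`-action of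
character `cubicNewvectorChar q` = the cubic principal series `PS(χ, χ⁻¹)`, and `(𝓛∕3𝓛)^G = 0`), `uU = (1 1; 0 1)`, `uL = (1 0; 1 1)`. If `a₁` is fixed by `uU`,
`a₂` by `uL` and `a₁ + a₂ ∈ 3𝓛`, then `a₁ ∈ 3𝓛`. PROOF (no modular representation theory, no Brauer characters):
(1) `a₁` is fixed by every upper unipotent `U(y) = uU^y`, and `ā₁ = −ā₂ (mod 3)` is fixed mod `3` by every lower unipotent `L(y) = uL^y`;
(2) the set of `g` fixing `a₁` mod `3` is closed under products, hence (explicit factorisations `diag(t, t⁻¹) = U(t)L(−t⁻¹)U(t)·U(−1)L(1)U(−1)`,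
    `g = U((a−1)∕c) L(c) U((d−1)∕c)` for `det g = 1`, `c ≠ 0`, and `g = L(−1)·(L(1) g)` for `c = 0`) contains `SL₂(𝔽_q)`;
(3) on the `U`-fixed sublattice the centre acts trivially (LEMMA Z, `CartanTorusCubeCut.PS.rho_apply_of_isScalar`) and so does every CUBE `diag(b³, 1)`
    (`CartanTorusCubeCut.PS.rho_cube_comp_normU`, the (F2a) engine: `ρ(diag(b,1)) ∘ N_U = N_U` for `b^{(q−1)/3} = 1`); hence
    `ρ(diag(t², 1)) a₁ = ρ(diag(t, t⁻¹)) a₁ ≡ a₁`, so `ρ(diag(t⁴,1)) a₁ ≡ a₁`, and `diag(t⁴, 1) = diag(t, 1)·diag(t³, 1)` gives `ρ(diag(t,1)) a₁ ≡ a₁ (mod 3)`;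
(4) `G = {diag(det g, 1)}·SL₂(𝔽_q)`, so `ā₁ ∈ (𝓛∕3𝓛)^G = 0`, i.e. `a₁ ∈ 3𝓛`.
CONSEQUENCES: `satThree_ofDegreeData` (every torus–degree datum forgets to a SATURATED pre-datum), `saturatedDictionary_of_dictionaryVal` ((F2b♭) → (F2b♮)),
`saturatedDictionary_iff_dictionaryVal`, `saturatedDictionary_iff_onePlaceLaw` ((F2b♮) ↔ NUM), `saturatedDictionary_of_onePlaceLaw`.
HONEST FRAMING: finite-group theory + bookkeeping only. (F2b♮), (F2b♭), NUM, crux 23422, crux 19109 are NOT proved here (only their mutual equivalence);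
no route item and no registered stub is proved; no summit statement is proved; BSD is proved for no curve. Searched before filing (2026-08-29):
`lean search 'SatThree'` ∕ `'saturatedDictionary'` (only FILE B's ♮ ⇒ ♭); the tree's (F2a) files prove the cube and centre relations used in (3). [folklore]
-/

set_option linter.dupNamespace false
set_option autoImplicit false

namespace Summit.BirchSwinnertonDyer.BirchSwinnertonDyer.Theorems.CartanSatOfNoFixed

open Summit.BirchSwinnertonDyer.BirchSwinnertonDyer.Theorems.CartanDegree
open Summit.BirchSwinnertonDyer.BirchSwinnertonDyer.Theorems.CartanTorusCubeCut
open Summit.BirchSwinnertonDyer.BirchSwinnertonDyer.Theorems.CartanTorusCubeCut.PS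
open Summit.BirchSwinnertonDyer.BirchSwinnertonDyer.Theorems.CartanSupply.PSNoFixed
open Summit.BirchSwinnertonDyer.BirchSwinnertonDyer.Theorems.CartanSaturatedDictionary
open scoped Classical

/-! ## §1 Fixing a vector modulo `3` (`ρ(g) a − a ∈ 3ℤ^d`, written out — no definition): closure under products and powers -/

section cong

variable {G : Type*} [Group G] {d : ℕ} (ρ : Representation ℤ G (Fin d → ℤ))

/-- PROVED: a vector fixed by `g` is fixed by `g` modulo `3`. [folklore] -/
theorem fixMod3_of_fixed {a : Fin d → ℤ} {g : G} (h : ρ g a = a) : ∃ w : Fin d → ℤ, ρ g a - a = (3 : ℤ) • w :=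
  ⟨0, by rw [h, sub_self, smul_zero]⟩

/-- PROVED: closure under products — `ρ(gh)a − a = ρ(g)(ρ(h)a − a) + (ρ(g)a − a)`. [folklore] -/
theorem fixMod3_mul {a : Fin d → ℤ} {g h : G} (hg : ∃ w : Fin d → ℤ, ρ g a - a = (3 : ℤ) • w)
    (hh : ∃ w : Fin d → ℤ, ρ h a - a = (3 : ℤ) • w) : ∃ w : Fin d → ℤ, ρ (g * h) a - a = (3 : ℤ) • w := by
  obtain ⟨w₁, hw₁⟩ := hg
  obtain ⟨w₂, hw₂⟩ := hh
  refine ⟨ρ g w₂ + w₁, ?_⟩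
  have e1 : ρ (g * h) a = ρ g (ρ h a) := by rw [map_mul]; rfl
  have e2 : ρ h a = a + (3 : ℤ) • w₂ := by rw [← hw₂]; abel
  rw [e1, e2, map_add, map_zsmul, smul_add, ← hw₁]
  abel

/-- PROVED: the relation only depends on `ρ(g) a`. [folklore] -/
theorem fixMod3_congr {a : Fin d → ℤ} {g g' : G} (he : ρ g a = ρ g' a) (hg : ∃ w : Fin d → ℤ, ρ g a - a = (3 : ℤ) • w) :
    ∃ w : Fin d → ℤ, ρ g' a - a = (3 : ℤ) • w := by
  obtain ⟨w, hw⟩ := hg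
  exact ⟨w, by rw [← he, hw]⟩

/-- PROVED: a vector fixed by `g` is fixed by every power of `g`. [folklore] -/
theorem apply_pow_of_fixed {a : Fin d → ℤ} {g : G} (h : ρ g a = a) (n : ℕ) : ρ (g ^ n) a = a := by
  induction n with
  | zero => rw [pow_zero, map_one]; rfl
  | succ n ih =>
      have e : ρ (g ^ n * g) a = ρ (g ^ n) (ρ g a) := by rw [map_mul]; rfl
      rw [pow_succ, e, h, ih]

end cong

/-! ## §2 Matrix identities in `GL₂(𝔽_q)`: unipotent parametrisations and the `SL₂` factorisation -/

section matrices

variable {q : ℕ} [Fact q.Prime]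

/-- PROVED: the matrix of `uU ^ y.val` is `(1 y; 0 1)`. [folklore] -/
theorem coe_upper_pow_val (uU : G q) (huU : ((uU : G q) : Mat q) = !![1, 1; 0, 1]) (y : ZMod q) :
    ((uU ^ y.val : G q) : Mat q) = !![1, y; 0, 1] := by
  rw [coe_pow_of_upper_unipotent uU huU y.val, ZMod.natCast_zmod_val]

/-- PROVED: the matrix of `uL ^ y.val` is `(1 0; y 1)`. [folklore] -/
theorem coe_lower_pow_val (uL : G q) (huL : ((uL : G q) : Mat q) = !![1, 0; 1, 1]) (y : ZMod q) :
    ((uL ^ y.val : G q) : Mat q) = !![1, 0; y, 1] := by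
  rw [coe_pow_of_lower_unipotent uL huL y.val, ZMod.natCast_zmod_val]

/-- PROVED — **`SL₂` FACTORISATION off the Borel**: a `2 × 2` matrix of determinant `1` with non-zero lower-left entry `c` is
`U((a−1)∕c) · L(c) · U((d−1)∕c)` with `U(x) = (1 x; 0 1)`, `L(c) = (1 0; c 1)`. [folklore] -/
theorem sl_factor (g : Mat q) (hdet : g.det = 1) (hc : g 1 0 ≠ 0) :
    ∃ x y c : ZMod q, !![1, x; 0, 1] * !![1, 0; c, 1] * !![1, y; 0, 1] = g := by
  refine ⟨(g 0 0 - 1) * (g 1 0)⁻¹, (g 1 1 - 1) * (g 1 0)⁻¹, g 1 0, ?_⟩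
  rw [Matrix.det_fin_two] at hdet
  have hinv : (g 1 0)⁻¹ * g 1 0 = 1 := inv_mul_cancel₀ hc
  rw [Matrix.mul_fin_two, Matrix.mul_fin_two]
  ext i j
  fin_cases i <;> fin_cases j
  · -- `1 + x c = g₀₀`
    simp only [Matrix.of_apply, Matrix.cons_val', Matrix.cons_val_zero, Matrix.cons_val_fin_one, Fin.zero_eta, Fin.isValue]
    linear_combination (g 0 0 - 1) * hinv
  · -- `(1 + x c) y + x = g₀₁`
    simp only [Matrix.of_apply, Matrix.cons_val', Matrix.cons_val_zero, Matrix.cons_val_one, Matrix.cons_val_fin_one,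
      Fin.zero_eta, Fin.mk_one, Fin.isValue]
    linear_combination (g 1 0)⁻¹ * hdet + (g 0 1 + (g 0 0 - 1) * (g 1 1 - 1) * (g 1 0)⁻¹) * hinv
  · simp
  · -- `c y + 1 = g₁₁`
    simp only [Matrix.of_apply, Matrix.cons_val', Matrix.cons_val_one, Matrix.cons_val_fin_one,
      Fin.mk_one, Fin.isValue]
    linear_combination (g 1 1 - 1) * hinv

end matrices

/-! ## §3 THE THEOREM: `(𝓛∕3𝓛)^G = 0` ⇒ (SAT₃) for every Cartan torus lattice at `q ≡ 1 (mod 3)` -/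

section main

variable {q : ℕ} [Fact q.Prime]

/-- PROVED — **UNIPOTENT SATURATION FROM THE MOD-3 CLAUSE** (`q ≡ 1 (mod 3)`): for a Cartan torus lattice `𝓛` (character `cubicNewvectorChar q`,
`(𝓛∕3𝓛)^G = 0`), `uU = (1 1; 0 1)`, `uL = (1 0; 1 1)`: if `a₁` is fixed by `uU`, `a₂` by `uL` and `a₁ + a₂ ∈ 3𝓛`, then `a₁ ∈ 3𝓛`.
Proof in the module docstring ((1) unipotent lines, (2) `SL₂` by explicit factorisation, (3) centre and cubes act trivially on `𝓛^U`
(`rho_apply_of_isScalar`, `rho_cube_comp_normU`) so `diag(t,1)` fixes `a₁` mod `3`, (4) `G = diag(det, 1)·SL₂` and `noFixedVectorModThree`). [folklore] -/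
theorem satThree_of_cartanTorusLattice (h1 : q % 3 = 1) (𝓛 : CartanTorusLattice q)
    (uU uL : G q) (huU : ((uU : G q) : Mat q) = !![1, 1; 0, 1]) (huL : ((uL : G q) : Mat q) = !![1, 0; 1, 1])
    (a₁ a₂ : Fin 𝓛.d → ℤ) (ha₁ : 𝓛.ρ uU a₁ = a₁) (ha₂ : 𝓛.ρ uL a₂ = a₂)
    (hsum : ∃ w : Fin 𝓛.d → ℤ, a₁ + a₂ = (3 : ℤ) • w) : ∃ w : Fin 𝓛.d → ℤ, a₁ = (3 : ℤ) • w := by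
  have hq : q.Prime := Fact.out
  obtain ⟨w₀, hw₀⟩ := hsum
  -- the unipotent parametrisations `U(y) = uU ^ y`, `L(y) = uL ^ y`
  let u : ZMod q → G q := fun y => uU ^ y.val
  have hu : ∀ y, ((u y : G q) : Mat q) = !![1, y; 0, 1] := fun y => coe_upper_pow_val uU huU y
  let l : ZMod q → G q := fun y => uL ^ y.val
  have hl : ∀ y, ((l y : G q) : Mat q) = !![1, 0; y, 1] := fun y => coe_lower_pow_val uL huL y
  -- (1) `a₁` is fixed by every `U(y)`; `a₂` by every `L(y)`; so `a₁ = 3w₀ − a₂` is fixed mod 3 by every `L(y)`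
  have hUfix : ∀ y, 𝓛.ρ (u y) a₁ = a₁ := fun y => apply_pow_of_fixed 𝓛.ρ ha₁ y.val
  have hLfix₂ : ∀ y, 𝓛.ρ (l y) a₂ = a₂ := fun y => apply_pow_of_fixed 𝓛.ρ ha₂ y.val
  have hU : ∀ y, (∃ w : Fin 𝓛.d → ℤ, 𝓛.ρ (u y) a₁ - a₁ = (3 : ℤ) • w) := fun y => fixMod3_of_fixed 𝓛.ρ (hUfix y)
  have ha₁' : a₁ = (3 : ℤ) • w₀ - a₂ := eq_sub_of_add_eq hw₀
  have hL : ∀ y, (∃ w : Fin 𝓛.d → ℤ, 𝓛.ρ (l y) a₁ - a₁ = (3 : ℤ) • w) := by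
    intro y
    refine ⟨𝓛.ρ (l y) w₀ - w₀, ?_⟩
    rw [ha₁', map_sub, map_zsmul, hLfix₂ y, smul_sub]
    abel
  -- (2) every element of determinant `1` fixes `a₁` mod 3
  have hne : ∀ g : G q, (g : Mat q).det = 1 → (g : Mat q) 1 0 ≠ 0 → (∃ w : Fin 𝓛.d → ℤ, 𝓛.ρ g a₁ - a₁ = (3 : ℤ) • w) := by
    intro g hdet hc
    obtain ⟨x, y, c, hfac⟩ := sl_factor (g : Mat q) hdet hc
    have hg : g = u x * l c * u y :=
      Units.ext (by rw [Units.val_mul, Units.val_mul, hu, hl, hu]; exact hfac.symm)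
    rw [hg]
    exact fixMod3_mul 𝓛.ρ (fixMod3_mul 𝓛.ρ (hU x) (hL c)) (hU y)
  have hSL : ∀ g : G q, (g : Mat q).det = 1 → (∃ w : Fin 𝓛.d → ℤ, 𝓛.ρ g a₁ - a₁ = (3 : ℤ) • w) := by
    intro g hdet
    by_cases hc : (g : Mat q) 1 0 = 0
    · -- `g = L(−1) · (L(1) g)`, and `L(1) g` has lower-left entry `g₀₀ ≠ 0`
      have hll : l (-1) * l 1 = 1 := by
        apply Units.ext
        rw [Units.val_mul, hl, hl, Units.val_one, Matrix.mul_fin_two]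
        ext i j
        fin_cases i <;> fin_cases j <;> simp
      have hg : g = l (-1) * (l 1 * g) := by rw [← mul_assoc, hll, one_mul]
      have hdet' : ((l 1 * g : G q) : Mat q).det = 1 := by
        rw [Units.val_mul, Matrix.det_mul, hl, Matrix.det_fin_two_of, hdet]
        ring
      have hc' : ((l 1 * g : G q) : Mat q) 1 0 ≠ 0 := by
        have e : ((l 1 * g : G q) : Mat q) 1 0 = (g : Mat q) 0 0 + (g : Mat q) 1 0 := by
          rw [Units.val_mul, hl, Matrix.mul_apply, Fin.sum_univ_two]
          simp
        rw [e, hc, add_zero]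
        intro h00
        rw [Matrix.det_fin_two, hc, h00] at hdet
        simp at hdet
      rw [hg]
      exact fixMod3_mul 𝓛.ρ (hL (-1)) (hne _ hdet' hc')
    · exact hne g hdet hc
  -- (3) diagonal elements: cubes and the centre act trivially on the `U`-fixed vector `a₁`
  have hcube : ∀ b : (ZMod q)ˣ, (b : ZMod q) ^ ((q - 1) / 3) = 1 → 𝓛.ρ (diagGL ![b, 1]) a₁ = a₁ := by
    intro b hb
    have key := rho_cube_comp_normU u hu 𝓛 h1 hb
    have hNU : (∑ y : ZMod q, 𝓛.ρ (u y)) a₁ = (q : ℤ) • a₁ := by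
      rw [LinearMap.sum_apply, Finset.sum_congr rfl (fun y _ => hUfix y), Finset.sum_const, Finset.card_univ,
        ZMod.card, Nat.cast_smul_eq_nsmul]
    have h := congrArg (fun f => f a₁) key
    simp only [Module.End.mul_apply, hNU, map_zsmul] at h
    exact smul_right_injective (Fin 𝓛.d → ℤ) (show (q : ℤ) ≠ 0 by exact_mod_cast hq.ne_zero) h
  have hpow3 : ∀ t : (ZMod q)ˣ, ((t ^ 3 : (ZMod q)ˣ) : ZMod q) ^ ((q - 1) / 3) = 1 := by
    intro t
    rw [Units.val_pow_eq_pow_val, ← pow_mul, three_mul_k h1]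
    exact ZMod.pow_card_sub_one_eq_one t.ne_zero
  have hD : ∀ t : (ZMod q)ˣ, (∃ w : Fin 𝓛.d → ℤ, 𝓛.ρ (diagGL ![t, 1]) a₁ - a₁ = (3 : ℤ) • w) := by
    intro t
    -- `diag(t, t⁻¹) ∈ SL₂` fixes `a₁` mod 3 and acts on `𝓛` as `diag(t², 1)` (the centre acts trivially, LEMMA Z)
    have hdt : (∃ w : Fin 𝓛.d → ℤ, 𝓛.ρ (diagGL ![t, t⁻¹]) a₁ - a₁ = (3 : ℤ) • w) := by
      apply hSL
      rw [diagGL_coe', Matrix.det_fin_two_of]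
      simp only [Matrix.cons_val_zero, Matrix.cons_val_one, mul_zero, sub_zero]
      rw [← Units.val_mul, mul_inv_cancel, Units.val_one]
    have hρ : 𝓛.ρ (diagGL ![t, t⁻¹]) a₁ = 𝓛.ρ (diagGL ![t * t, 1]) a₁ := by
      rw [rho_diagGL 𝓛 ![t, t⁻¹]]
      simp only [Matrix.cons_val_zero, Matrix.cons_val_one, inv_inv]
    have h2 : (∃ w : Fin 𝓛.d → ℤ, 𝓛.ρ (diagGL ![t * t, 1]) a₁ - a₁ = (3 : ℤ) • w) := fixMod3_congr 𝓛.ρ hρ hdt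
    have h4 : (∃ w : Fin 𝓛.d → ℤ, 𝓛.ρ (diagGL ![t * t, 1] * diagGL ![t * t, 1]) a₁ - a₁ = (3 : ℤ) • w) := fixMod3_mul 𝓛.ρ h2 h2
    -- `diag(t⁴, 1) = diag(t, 1) · diag(t³, 1)` and the cube `t³` acts trivially on `a₁`
    have he : diagGL ![t * t, 1] * diagGL ![t * t, 1] = diagGL ![t, 1] * diagGL ![t ^ 3, 1] := by
      rw [diagGL_mirabolic_mul, diagGL_mirabolic_mul]
      congr 1
      funext i
      fin_cases i
      · simp only [Fin.zero_eta, Fin.isValue, Matrix.cons_val_zero, pow_succ, pow_zero, one_mul, mul_assoc]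
      · simp only [Fin.mk_one, Fin.isValue, Matrix.cons_val_one, Matrix.cons_val_fin_one]
    rw [he] at h4
    have hρ' : 𝓛.ρ (diagGL ![t, 1] * diagGL ![t ^ 3, 1]) a₁ = 𝓛.ρ (diagGL ![t, 1]) a₁ := by
      have e : 𝓛.ρ (diagGL ![t, 1] * diagGL ![t ^ 3, 1]) a₁ = 𝓛.ρ (diagGL ![t, 1]) (𝓛.ρ (diagGL ![t ^ 3, 1]) a₁) := by
        rw [map_mul]; rfl
      rw [e, hcube (t ^ 3) (hpow3 t)]
    exact fixMod3_congr 𝓛.ρ hρ' h4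
  -- (4) all of `G = diag(det g, 1) · SL₂`
  have hall : ∀ g : G q, (∃ w : Fin 𝓛.d → ℤ, 𝓛.ρ g a₁ - a₁ = (3 : ℤ) • w) := by
    intro g
    have hdet : (((diagGL ![Matrix.GeneralLinearGroup.det g, 1])⁻¹ * g : G q) : Mat q).det = 1 := by
      rw [← Matrix.GeneralLinearGroup.val_det_apply, map_mul, map_inv]
      have e : Matrix.GeneralLinearGroup.det (diagGL ![Matrix.GeneralLinearGroup.det g, 1] : G q) =
          Matrix.GeneralLinearGroup.det g := by
        apply Units.ext
        rw [Matrix.GeneralLinearGroup.val_det_apply, diagGL_coe', Matrix.det_fin_two_of]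
        simp only [Matrix.cons_val_zero, Matrix.cons_val_one, Units.val_one, mul_one, mul_zero, sub_zero]
      rw [e, inv_mul_cancel, Units.val_one]
    have h := fixMod3_mul 𝓛.ρ (hD (Matrix.GeneralLinearGroup.det g)) (hSL _ hdet)
    rwa [mul_inv_cancel_left] at h
  exact 𝓛.noFixedVectorModThree a₁ (fun g => hall g)

/-- PROVED — packaged on the pre-datum: every torus–degree datum at a prime `q ≡ 1 (mod 3)` forgets to a pre-datum which SATISFIES (SAT₃). [folklore] -/
theorem satThree_ofDegreeData (h1 : q % 3 = 1) (𝒟 : CartanTorusDegreeData q) :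
    (CartanTorusDegreeDataPre.ofDegreeData 𝒟).SatThree := by
  intro uU uL huU huL a₁ a₂ ha₁ ha₂ hsum
  exact satThree_of_cartanTorusLattice h1 𝒟.toCartanTorusLattice uU uL huU huL a₁ a₂ ha₁ ha₂ hsum

end main

/-! ## §4 (F2b♭) → (F2b♮); (F2b♮) ⟺ (F2b♭) ⟺ NUM -/

/-- PROVED — **(F2b♭) → (F2b♮)**: the one-place Hom-lattice dictionary in its 3-adic form implies the SATURATED dictionary (forget the mod-3 clause of the datum,
keep the degrees, and (SAT₃) holds by `satThree_ofDegreeData`). The converse is bsd-idea-10 g14's `dictionaryVal_of_saturatedDictionary`. [folklore] -/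
theorem saturatedDictionary_of_dictionaryVal (h : CartanHomLatticeDictionaryAtThreeVal) :
    CartanHomLatticeSaturatedDictionaryAtThree := by
  intro V _ _ hX hS N D M C q _ X W₁ _ Q X' W₂ _ Q' hN hDMC hq hq3 hq3N hc hQ hQ'
  obtain ⟨𝒟, hd1, hd2⟩ := h V hX hS N D M C q X W₁ Q X' W₂ Q' hN hDMC hq hq3 hq3N hc hQ hQ'
  exact ⟨CartanTorusDegreeDataPre.ofDegreeData 𝒟, fun h1 => satThree_ofDegreeData h1 𝒟, hd1, hd2⟩

/-- PROVED — **(F2b♮) ⟺ (F2b♭)**. [folklore] -/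
theorem saturatedDictionary_iff_dictionaryVal :
    CartanHomLatticeSaturatedDictionaryAtThree ↔ CartanHomLatticeDictionaryAtThreeVal :=
  ⟨dictionaryVal_of_saturatedDictionary, saturatedDictionary_of_dictionaryVal⟩

/-- PROVED — **(F2b♮) ⟺ NUM**, UNCONDITIONALLY: the v14 stub of line `cartan` (`CartanSaturatedDictionary.CartanHomLatticeSaturatedDictionaryAtThree`) is
EQUIVALENT to the registered stub `CartanCorrespondence.CartanOnePlaceDegreeLawAtThree` (the lattice supply is the tree theorem
`CartanSupply.Monomial.cartanTorusLatticeSupply_holds`; `CartanF2bResidue.dictionaryVal_iff_onePlaceLaw`). [folklore] -/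
theorem saturatedDictionary_iff_onePlaceLaw :
    CartanHomLatticeSaturatedDictionaryAtThree ↔ CartanCorrespondence.CartanOnePlaceDegreeLawAtThree :=
  saturatedDictionary_iff_dictionaryVal.trans
    (CartanF2bResidue.dictionaryVal_iff_onePlaceLaw CartanSupply.Monomial.cartanTorusLatticeSupply_holds)

/-- PROVED — **NUM → (F2b♮)**: a proof of the bare one-place degree law closes the v14 node. [folklore] -/
theorem saturatedDictionary_of_onePlaceLaw (h : CartanCorrespondence.CartanOnePlaceDegreeLawAtThree) :
    CartanHomLatticeSaturatedDictionaryAtThree :=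
  saturatedDictionary_iff_onePlaceLaw.2 h

end Summit.BirchSwinnertonDyer.BirchSwinnertonDyer.Theorems.CartanSatOfNoFixed
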